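import Summits.CriticalPhenomena.PercolationContinuityZ3.Theorems.PercNearOneGluingNoHeavyConstsFourPointSetSplit
import HarnessLib

/-!
# The set-split conjectures (R) and (SUB): typed statements, and (R) ⟹ (ED)

builds on p205010 (kernel theorem, internal audit signed; external expert review pending)

PAPER-2 track "percolation constants", part (ii), seat `prim-consts-1`, gen 25 (lane index `run/shared/lean/prim/consts/CONSTANTS.md`,
row A19; memo `FROM-prim-consts-1-g25-SET-SPLIT.md`).  Support file for the crux `NoHeavyLowerTail` (stmt-CriticalPhenomena-4575;
`--supports`): two `Prop` definitions (OPEN statements, tagged `@[conjecture]`) and one theorem; no sorries; standard axioms.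
Nothing here claims the conjectures.

Notation (finite weighted graph on `Fin n`, `μ = prodBernoulli w`, vertices `a b c d`; `{S ↮ T}` = no open path joins `S` to `T`).
For a set `S` of the four points write `D(S) := μ(S ↮ {a,b,c,d} ∖ S)`; so `D(S) = D(Sᶜ)`, `D(a) = μ(a ↮ bcd)` is the isolation
probability and `D(ab) = μ(ab ↮ cd)` a balanced separation.  For graph CUTS the set function `S ↦ mincut(S, Sᶜ)` satisfies every
"Hamming" inequality: if `U₁,…,U_k` are vertex sets and `V₁,…,V_l` unions of their Venn cells such that every pair of cells is
separated by at most as many `V_j` as `U_i`, then `Σ cut V_j ≤ Σ cut U_i` (an edge has two endpoints; kernel instance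
`Consts.cut_fourPoint`, gen 6).  For four points the non-trivial instances are, with `f = −log D`:
  (R)   `f(ab) + f(ac) + f(ad) ≥ f(a) + f(b) + f(c) + f(d)`  (three sets, odd Venn cells),
  (SUB) `f(ab) + f(ac) ≥ f(a) + f(abc)`  and  (DIFF) `f(ab) + f(ac) ≥ f(b) + f(c)`  (two sets).
The conjectures below say that bond percolation inherits (R) and (SUB) from its min-cut (`ε → 0`) limit.  They FAIL for site
percolation (one site of probability `1/2` joined to `a,b,c,d`: `D ≡ 1/2`, so (R) reads `1/8 ≤ 1/16`) — equivalently for the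
4-hyperedge, which bond percolation cannot simulate even approximately (Gladkov–Zimin, Thm. 3.2) — so no proof can consist of
correlation inequalities valid for site percolation applied to the seven events; the two-endpoint structure of edges must enter.

* `Consts.FourPointSetSplit` — **CONJECTURE (R)**: `D(ab)·D(ac)·D(ad) ≤ D(a)·D(b)·D(c)·D(d)`.  EQUIVALENT to (ED) `Consts.FourPointSplit`:
  (R) ⟹ (ED) is `Consts.fourPointSplit_of_fourPointSetSplit` below (kernel); (ED) ⟹ (R) by terminal sums (memo §1: every `D(S)` is
  multiplicative under gluing graphs at `{a,b,c,d}`, and the exact-pairing probability of the `m`-fold sum is `D(ab)^m(1 + o(1))`).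
  KERNEL CLASS: every hub graph `K_{4,r}` (`Consts.Hub.setSplit`, via the one-hub Bernstein certificate `Consts.apex_setSplit`).
  Equality on every weighted `K₄` (so on every graph on the four terminals alone, e.g. the path `a–b–c–d`), on `K₄` plus pendant hubs
  of degree `≤ 3`, and on graphs disconnected along a balanced split; STRICT on the 4-star (a tree), slack `5αβγδ` to fourth order.  Evidence (census — proves nothing): corner-seeking weight optimisation (palette `{10⁻³,…,1−10⁻³}` plus multiplicative moves,
  acceptance threshold `10⁻¹²` relative) over random, near-`K₄` and tree-like graph shapes on `≤ 8` vertices, kit job j249284 of this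
  gen (`--workitem` stmt-4575): maximum ratio `1` (equality cases only), no violation; exact series: `K₄` + apex `F − 1 = −5αβγδ·e⁴`,
  H-graphs first order in the bridge weight negative.
* `Consts.FourPointSetSplitSubmodular` — **CONJECTURE (SUB)**: `D(ab)·D(ac) ≤ D(a)·D(abc)` — submodularity of `S ↦ −log μ(S ↮ Sᶜ)`
  on a four-point set (the three-point case `μ(a↮bc)μ(c↮ab) ≤ μ(b↮ac)` is Harris plus inclusion).  Lossy by `μ`-factors on `K₄`
  (ratio `q_bc²`) and on the 4-star, tight on the path `b–a–d–c`; same census, no violation.  Not comparable with (R).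
* `Consts.fourPointSplit_of_fourPointSetSplit` — (R) ⟹ (ED) (from `Consts.fourPointSplit_of_setSplit`).
References: N. Gladkov, arXiv:2408.08457v2 (2024), §8 (Main Lemma 8.1, the decision-tree technology expected to bear on (R));
N. Gladkov, A. Zimin, arXiv:2404.08873 (2024), Thm. 3.2; J. van den Berg, J. Kahn, Ann. Probab. 29 (2001) 123–126, Thm. 1.2 (the
one-source submodularity `P(s↮X)P(s↮Y) ≤ P(s↮X∩Y)P(s↮X∪Y)`, of which (SUB) is a two-source analogue); G. Grimmett, *Percolation*
(1999), §2.2.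
-/

noncomputable section

namespace Summit.CriticalPhenomena.PercolationContinuityZ3.Theorems

open MeasureTheory Set Literature.Probability.LatticeModels Literature.Probability.Percolation
open scoped Classical

namespace Consts

/-- **CONJECTURE (R) — the four-point SET-split inequality.**  For every finite weighted graph (`Fin n`, weights `w`,
`μ = prodBernoulli w`) and vertices `a b c d`:
`μ(ab ↮ cd) · μ(ac ↮ bd) · μ(ad ↮ bc) ≤ μ(a ↮ bcd) · μ(b ↮ acd) · μ(c ↮ abd) · μ(d ↮ abc)`,
where `{ab ↮ cd} = {a↮c, a↮d, b↮c, b↮d}` and `{a ↮ bcd} = {a↮b, a↮c, a↮d}`.  OPEN (conjectured in this programme, PAPER-2 consts track,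
seat prim-consts-1 gen 25, 2026-08-26); EQUIVALENT to `Consts.FourPointSplit` (ED); proved on every hub graph `K_{4,r}`
(`Consts.Hub.setSplit`); false for site percolation; no violation in the corner-seeking census on `≤ 8` vertices (kit j249284).
builds on p205010 (kernel theorem, internal audit signed; external expert review pending).
[cite: Gladkov2024, §8 Main Lemma 8.1 (expected proof technology); GladkovZimin2024, Thm. 3.2 (the site law violating it is not
bond-realisable)] [status: open] -/
@[conjecture] def FourPointSetSplit : Prop :=
  ∀ (n : ℕ) (w : Sym2 (Fin n) → unitInterval) (a b c d : Fin n),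
    (prodBernoulli w).real ((openConn a c)ᶜ ∩ (openConn a d)ᶜ ∩ (openConn b c)ᶜ ∩ (openConn b d)ᶜ) *
        (prodBernoulli w).real ((openConn a b)ᶜ ∩ (openConn a d)ᶜ ∩ (openConn c b)ᶜ ∩ (openConn c d)ᶜ) *
        (prodBernoulli w).real ((openConn a b)ᶜ ∩ (openConn a c)ᶜ ∩ (openConn d b)ᶜ ∩ (openConn d c)ᶜ) ≤
      (prodBernoulli w).real ((openConn a b)ᶜ ∩ (openConn a c)ᶜ ∩ (openConn a d)ᶜ) *
        (prodBernoulli w).real ((openConn b a)ᶜ ∩ (openConn b c)ᶜ ∩ (openConn b d)ᶜ) *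
        (prodBernoulli w).real ((openConn c a)ᶜ ∩ (openConn c b)ᶜ ∩ (openConn c d)ᶜ) *
        (prodBernoulli w).real ((openConn d a)ᶜ ∩ (openConn d b)ᶜ ∩ (openConn d c)ᶜ)

/-- **CONJECTURE (SUB) — submodularity of the set-disconnection exponent on four points.**  For every finite weighted graph and
vertices `a b c d`: `μ(ab ↮ cd) · μ(ac ↮ bd) ≤ μ(a ↮ bcd) · μ(abc ↮ d)`.  OPEN (conjectured in this programme, seat prim-consts-1 gen 25,
2026-08-26; the three-point case is Harris' inequality; no violation in the corner-seeking census on `≤ 7` vertices, kit j249284).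
builds on p205010 (kernel theorem, internal audit signed; external expert review pending).
[cite: VandenbergKahn2001, Thm. 1.2 (the one-source form `P(s↮X)P(s↮Y) ≤ P(s↮X∩Y)P(s↮X∪Y)`)] [status: open] -/
@[conjecture] def FourPointSetSplitSubmodular : Prop :=
  ∀ (n : ℕ) (w : Sym2 (Fin n) → unitInterval) (a b c d : Fin n),
    (prodBernoulli w).real ((openConn a c)ᶜ ∩ (openConn a d)ᶜ ∩ (openConn b c)ᶜ ∩ (openConn b d)ᶜ) *
        (prodBernoulli w).real ((openConn a b)ᶜ ∩ (openConn a d)ᶜ ∩ (openConn c b)ᶜ ∩ (openConn c d)ᶜ) ≤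
      (prodBernoulli w).real ((openConn a b)ᶜ ∩ (openConn a c)ᶜ ∩ (openConn a d)ᶜ) *
        (prodBernoulli w).real ((openConn d a)ᶜ ∩ (openConn d b)ᶜ ∩ (openConn d c)ᶜ)

/-- **(R) ⟹ (ED).** [derived here] -/
theorem fourPointSplit_of_fourPointSetSplit (h : FourPointSetSplit) : FourPointSplit :=
  fourPointSplit_of_setSplit h

end Consts

end Summit.CriticalPhenomena.PercolationContinuityZ3.Theorems
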